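import Literature.Analysis.FluidPDE.ClassicalSolution
import Literature.Analysis.FluidPDE.VectorCalculus
import HarnessLib

/-!
# Smooth finite-energy solutions of Navier–Stokes: automatic energy dissipation bound
(family: NS; trunk FluidKinetic; namespace `Literature.NS`)

Named fact (no proof; `def … : Prop`) from

* T. Tao, *Localisation and compactness properties of the Navier–Stokes global regularity
  problem*, Anal. PDE 6 (2013) 25–107, arXiv:1108.1165 [cite: Tao2011].

Tao's *smooth finite energy solution* `(u, p, u₀, f, T)` (§1, p. 3): `u, p` smooth on
`[0, T] × ℝ³`, Navier–Stokes with `ν = 1` and force `f`, `u(0) = u₀`, data of finite energy, and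
`‖u‖_{L^∞_t L²_x([0,T] × ℝ³)} < ∞` (his (6) = Fefferman's (7)); the dissipation condition
`∇u ∈ L²_t L²_x` is deliberately *omitted* from the definition (footnote 2, following Fefferman)
and shown to be automatic:

* `NS.tao_finite_energy_smooth_energy_bound` — **Lemma 8.1 (Global energy inequality)**: for a
  finite energy (almost) smooth solution,
  `‖u‖_{L^∞_t L²_x([0,T]×ℝ³)} + ‖∇u‖_{L²_t L²_x([0,T]×ℝ³)} ≲ E(u₀, f, T)^{1/2}`, with an absolute
  implied constant (in particular *not* depending on the a priori bound `‖u‖_{L^∞ L²}`); "in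
  particular, `u` lies in `X¹([0,T] × ℝ³)`".

Rendering. Homogeneous case `f = 0` only (then `E(u₀, 0, T) = ½ ‖u₀‖²_{L²}`). Tao normalises
`ν = 1` (footnote 3); a general viscosity `ν > 0` is reduced to it by the exact symmetry
`v(s, y) = ν⁻¹ u(s/ν, y)`, under which (53) squared reads
`sup_t ‖u(t)‖²_{L²} + ν ∫₀ᵀ ∫ |∇u|² ≤ C ‖u₀‖²_{L²}` — the form stated here, with lower Lebesgue
integrals and the accepted dissipation density `Fluid.frobeniusNormSq (fderiv ℝ (u t) x)`
(= `|∇u(t,x)|²`). "Smooth solution on `[0, T] × ℝ³`" is the accepted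
`Fluid.IsClassicalNSSolutionOn (Icc 0 T) ν 0 u p` (jointly `C^∞` on `[0,T] × ℝ³`, momentum
equation with the time derivative taken within `[0, T]`, `div u = 0`); a Clay-class solution on
`[0, ∞)` (`NS.IsNavierStokesSolution ∧ IsSmoothOnHalfSpace u ∧ IsSmoothOnHalfSpace p`, bridge
`NS.isNavierStokesSolution_and_smooth_iff`) restricts to one by `IsClassicalNSSolutionOn.mono`.
The finite-energy hypothesis is `∀ t ∈ [0,T], ∫ |u(t)|² ≤ A` for some finite `A` (Tao's (6) plus
(56), the latter a consequence of smoothness and Fatou).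
-/

open Set MeasureTheory
open scoped ENNReal

namespace Literature.Analysis.FluidPDE

local notation "ℝ³" => EuclideanSpace ℝ (Fin 3)

/-- **Global energy inequality for smooth finite-energy solutions** (Tao, Anal. PDE 6 (2013),
arXiv:1108.1165, Lemma 8.1; footnote 2: "the finite energy dissipation condition
`∇u ∈ L²_t L²_x([0,T] × ℝ³)` … is actually automatic from (6) and smoothness"). There is an
absolute constant `C` such that: for every `ν > 0`, `T > 0` and every classical solution `(u, p)`
of the unforced Navier–Stokes equations on `ℝ³ × [0, T]` (jointly smooth on the closed slab)
with `sup_{t ∈ [0,T]} ∫ |u(t,x)|² dx < ∞`, one has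
`sup_{t ∈ [0,T]} ∫ |u(t)|² + ν ∫₀ᵀ ∫ |∇u|² dx dt ≤ C ∫ |u(0)|² dx`; in particular
`∇u ∈ L²((0,T) × ℝ³)`. Homogeneous (`f = 0`) case of the printed lemma; `ν = 1` in print,
general `ν` by the rescaling `v(s,y) = ν⁻¹ u(s/ν, y)`. [cite: Tao2011, Lemma 8.1] -/
def tao_finite_energy_smooth_energy_bound : Prop :=
  ∃ C : ℝ≥0∞, C < ⊤ ∧
    ∀ (ν T : ℝ) (_hν : 0 < ν) (_hT : 0 < T) (u : ℝ → ℝ³ → ℝ³) (p : ℝ → ℝ³ → ℝ)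
      (_h : FluidPDE.IsClassicalNSSolutionOn (Icc 0 T) ν 0 u p)
      (_hE : ∃ A : ℝ≥0∞, A < ⊤ ∧ ∀ t ∈ Icc 0 T, ∫⁻ x, ‖u t x‖ₑ ^ 2 ≤ A),
      (∀ t ∈ Icc 0 T, ∫⁻ x, ‖u t x‖ₑ ^ 2 ≤ C * ∫⁻ x, ‖u 0 x‖ₑ ^ 2) ∧
        ENNReal.ofReal ν *
            ∫⁻ t in Ioo 0 T, ∫⁻ x, ENNReal.ofReal (FluidPDE.frobeniusNormSq (fderiv ℝ (u t) x)) ≤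
          C * ∫⁻ x, ‖u 0 x‖ₑ ^ 2

end Literature.Analysis.FluidPDE
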